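import Mathlib
import Literature.AlgebraicGeometry.Resolution.CobordantGame
import Literature.AlgebraicGeometry.Resolution.FormalCoordinateChange
import Summits.ResolutionOfSingularities.ResolutionOfSingularities.Theorems.WeightedInvariantLocalWeightedDropTerminalDoublePointsAux
import Summits.ResolutionOfSingularities.ResolutionOfSingularities.Theorems.WeightedInvariantLocalWeightedDropInsepPointStep

/-!
# `WeightedInvariant.LocalWeightedDrop`, line `hasse-ridge-face-selection`: the LIFT for the purely inseparable char-`2`
# double points (`N4` restricted to the class INSEP, with cleaning and exits built in)

Crux item stmt-ResolutionOfSingularities-8899 `LocalWeightedDrop` (route `ResolutionOfSingularities/WeightedInvariant`),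
serving the door `WeightedConstruction` stmt-ResolutionOfSingularities-0571.  [OURS · L1 W4.3, chain w43, stub worker 3
(gen 2): the INTERFACE for the descent (u3) of CRUX-PLAN v2 §v2.3, piece S2iM `stub_charTwoInseparableReductionWon` of the
skeleton draft v21/v21b; NOT a statement of any manuscript.]

`insepWon_of_rank` (characteristic `2`, `k` algebraically closed, only the one-variable singular germs assumed won).
POSITIONS are the series `A₀ ∈ k[[x₀,x₁]]` with `ord A₀ > 2` (the germ is `y² + A₀`); an EXIT CLASS `T` of positions
already known to be won is a parameter (for S2iM: the terminal cases of `stub_charTwoInseparableTerminalWon`).  THE THEOREM: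
if an ordinal rank `κ` has the STEP PROPERTY — from every position outside `T` the rank player names ONE of
* a CLEANING `A₀ ↦ A₀ + φ²` (`φ(0) = 0`, again a position; `InsepDoublePoint.won_dp_add_sq_iff`),
* the POINT BLOW-UP (`won_insep_of_pointStep`: every cleaned same-class successor `A' + (αx₀+βx₁)²`,
  `A₀(π_{i₀,c}) = x₀² A'`, `α² = [x₀²]A'`, `β² = [x₁²]A'`),
* a permissible CURVE BLOW-UP `V(x_i, y)` (`won_insep_of_curveStep`: `A₀ = x_i² A₀'`, `A₀'(0) = 0`, cleaned successors
  `c² A₀'(ρ_{i,c}) + (αx₀+βx₁)²`),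
such that every resulting position is in `T` or has SMALLER RANK — then every position is won (well-founded induction on `κ`;
all other successors exit inside the step lemmas: non-singular, or hyperbolic by the cross term).

`charTwoInseparableReductionWon_of_insepRank`: the v21 stub S2iM VERBATIM follows from the existence, over every algebraically
closed field of characteristic `2`, of such a rank relative to the TERMINAL exit class — this is where the Hauser–Wagner /
Hauser–Perlega descent (height, bonus; the kangaroo correction) has to be supplied.
-/

set_option linter.dupNamespace false -- mandated namespace of this single-conjunct summit

namespace Summit.ResolutionOfSingularities.ResolutionOfSingularities.Theorems

open Literature.AlgebraicGeometry.Resolution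
open Literature.AlgebraicGeometry.Resolution.CobordantGame

open InsepDoublePoint TerminalDoublePoint MvPowerSeries in
/-- THE INSEP LIFT (characteristic `2`, `k` algebraically closed; one-variable singular germs won).  Given an exit class `T` of
won positions and an ordinal rank `κ` with the STEP PROPERTY (cleaning / point blow-up / permissible curve blow-up, every cleaned
same-class successor in `T` or of smaller rank), every `y² + A₀` with `ord A₀ > 2` is won. [OURS · L1 W4.3, interface for (u3)] -/
theorem insepWon_of_rank (k : Type) [Field k] [CharP k 2] [IsAlgClosed k]
    (hlow : ∀ g : MvPowerSeries (Fin 1) k, CobordantGame.IsSingular k g → CobordantGame.Won k 1 g)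
    (T : MvPowerSeries (Fin 2) k → Prop)
    (hT : ∀ A₀ : MvPowerSeries (Fin 2) k, T A₀ →
      CobordantGame.Won k 3 (X (Fin.last 2) ^ 2 + rename (Fin.succAboveEmb (Fin.last 2)) A₀))
    (κ : MvPowerSeries (Fin 2) k → Ordinal.{0})
    (hstep : ∀ A₀ : MvPowerSeries (Fin 2) k, (2 : ℕ∞) < A₀.order → T A₀ ∨
      (∃ φ : MvPowerSeries (Fin 2) k, constantCoeff φ = 0 ∧ (2 : ℕ∞) < (A₀ + φ ^ 2).order ∧
        (T (A₀ + φ ^ 2) ∨ κ (A₀ + φ ^ 2) < κ A₀)) ∨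
      (∀ (c : Fin 2 → k) (i₀ : Fin 2), c i₀ ≠ 0 → ∀ (A' : MvPowerSeries (Fin 2) k) (α β : k),
        subst (fun l : Fin 2 => if l = i₀ then C (c i₀) * X 0 else
          X 0 * (C (c l) + (X 1 : MvPowerSeries (Fin 2) k))) A₀ = X 0 ^ 2 * A' →
        α ^ 2 = coeff (Finsupp.single 0 2) A' → β ^ 2 = coeff (Finsupp.single 1 2) A' →
        (2 : ℕ∞) < (A' + (C α * X 0 + C β * X 1) ^ 2).order →
        T (A' + (C α * X 0 + C β * X 1) ^ 2) ∨ κ (A' + (C α * X 0 + C β * X 1) ^ 2) < κ A₀) ∨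
      (∃ (i : Fin 2) (A₀' : MvPowerSeries (Fin 2) k), A₀ = X i ^ 2 * A₀' ∧ constantCoeff A₀' = 0 ∧
        ∀ c : k, c ≠ 0 → ∀ (A' : MvPowerSeries (Fin 2) k) (α β : k),
        A' = C (c ^ 2) * subst (fun l : Fin 2 => if l = i then C c * X 0 else (X 1 : MvPowerSeries (Fin 2) k)) A₀' →
        α ^ 2 = coeff (Finsupp.single 0 2) A' → β ^ 2 = coeff (Finsupp.single 1 2) A' →
        (2 : ℕ∞) < (A' + (C α * X 0 + C β * X 1) ^ 2).order →
        T (A' + (C α * X 0 + C β * X 1) ^ 2) ∨ κ (A' + (C α * X 0 + C β * X 1) ^ 2) < κ A₀)) :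
    ∀ A₀ : MvPowerSeries (Fin 2) k, (2 : ℕ∞) < A₀.order →
      CobordantGame.Won k 3 (X (Fin.last 2) ^ 2 + rename (Fin.succAboveEmb (Fin.last 2)) A₀) := by
  suffices key : ∀ (o : Ordinal.{0}) (A₀ : MvPowerSeries (Fin 2) k), κ A₀ = o → (2 : ℕ∞) < A₀.order →
      Won k 3 (X (Fin.last 2) ^ 2 + rename (Fin.succAboveEmb (Fin.last 2)) A₀) from
    fun A₀ h => key _ A₀ rfl h
  intro o
  induction o using WellFoundedLT.induction with
  | ind o ih =>
  intro A₀ ho hA₀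
  -- a resulting position in `T` or of smaller rank is won
  have hres : ∀ B : MvPowerSeries (Fin 2) k, (2 : ℕ∞) < B.order → (T B ∨ κ B < κ A₀) →
      Won k 3 (X (Fin.last 2) ^ 2 + rename (Fin.succAboveEmb (Fin.last 2)) B) := by
    intro B hB hTB
    rcases hTB with hTB | hlt
    · exact hT B hTB
    · exact ih _ (ho ▸ hlt) B rfl hB
  rcases hstep A₀ hA₀ with hTA | ⟨φ, hφ, hordφ, hresφ⟩ | hpoint | ⟨i, A₀', hdiv, h0, hcurve⟩
  · exact hT A₀ hTA
  · exact (won_dp_add_sq_iff φ hφ A₀).mp (hres _ hordφ hresφ)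
  · exact won_insep_of_pointStep k hlow A₀ hA₀ fun c i₀ hc A' α β hfac hα hβ hord =>
      hres _ hord (hpoint c i₀ hc A' α β hfac hα hβ hord)
  · exact won_insep_of_curveStep k hlow i A₀ A₀' hdiv h0 fun c hc A' α β hA' hα hβ hord =>
      hres _ hord (hcurve c hc A' α β hA' hα hβ hord)

open InsepDoublePoint TerminalDoublePoint MvPowerSeries in
/-- S2iM FROM A RANK ON THE CLASS INSEP (the v21 stub `stub_charTwoInseparableReductionWon` VERBATIM as conclusion).  If over
every algebraically closed field of characteristic `2` there is an ordinal rank `κ` on `k[[x₀,x₁]]` with the step property of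
`insepWon_of_rank` relative to the TERMINAL exit class (binomial `x₀^r x₁^s · U`, `(r,s) ∉ 2ℕ²`, or `x_i^{2m} · g`, `ord g = 1`),
then — given the singular germs in `≤ 2` variables and the terminal double points — every `y² + A₀` with `ord A₀ > 2` is won.
The rank is the Hauser–Wagner / Hauser–Perlega descent datum (to be supplied: unit (u3) of CRUX-PLAN v2). [OURS · L1 W4.3] -/
theorem charTwoInseparableReductionWon_of_insepRank
    (hrank : ∀ (k : Type) [Field k] [CharP k 2] [IsAlgClosed k], ∃ κ : MvPowerSeries (Fin 2) k → Ordinal.{0},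
      ∀ A₀ : MvPowerSeries (Fin 2) k, (2 : ℕ∞) < A₀.order →
      let T : MvPowerSeries (Fin 2) k → Prop := fun B => (2 : ℕ∞) < B.order ∧
        ((∃ (r s : ℕ) (U : MvPowerSeries (Fin 2) k), constantCoeff U ≠ 0 ∧ ¬ (2 ∣ r ∧ 2 ∣ s) ∧
            B = X (0 : Fin 2) ^ r * X (1 : Fin 2) ^ s * U) ∨
          (∃ (i : Fin 2) (m : ℕ) (g : MvPowerSeries (Fin 2) k), 0 < m ∧ g.order = 1 ∧ B = X i ^ (2 * m) * g))
      T A₀ ∨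
      (∃ φ : MvPowerSeries (Fin 2) k, constantCoeff φ = 0 ∧ (2 : ℕ∞) < (A₀ + φ ^ 2).order ∧
        (T (A₀ + φ ^ 2) ∨ κ (A₀ + φ ^ 2) < κ A₀)) ∨
      (∀ (c : Fin 2 → k) (i₀ : Fin 2), c i₀ ≠ 0 → ∀ (A' : MvPowerSeries (Fin 2) k) (α β : k),
        subst (fun l : Fin 2 => if l = i₀ then C (c i₀) * X 0 else
          X 0 * (C (c l) + (X 1 : MvPowerSeries (Fin 2) k))) A₀ = X 0 ^ 2 * A' →
        α ^ 2 = coeff (Finsupp.single 0 2) A' → β ^ 2 = coeff (Finsupp.single 1 2) A' →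
        (2 : ℕ∞) < (A' + (C α * X 0 + C β * X 1) ^ 2).order →
        T (A' + (C α * X 0 + C β * X 1) ^ 2) ∨ κ (A' + (C α * X 0 + C β * X 1) ^ 2) < κ A₀) ∨
      (∃ (i : Fin 2) (A₀' : MvPowerSeries (Fin 2) k), A₀ = X i ^ 2 * A₀' ∧ constantCoeff A₀' = 0 ∧
        ∀ c : k, c ≠ 0 → ∀ (A' : MvPowerSeries (Fin 2) k) (α β : k),
        A' = C (c ^ 2) * subst (fun l : Fin 2 => if l = i then C c * X 0 else (X 1 : MvPowerSeries (Fin 2) k)) A₀' →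
        α ^ 2 = coeff (Finsupp.single 0 2) A' → β ^ 2 = coeff (Finsupp.single 1 2) A' →
        (2 : ℕ∞) < (A' + (C α * X 0 + C β * X 1) ^ 2).order →
        T (A' + (C α * X 0 + C β * X 1) ^ 2) ∨ κ (A' + (C α * X 0 + C β * X 1) ^ 2) < κ A₀)) :
    ∀ (k : Type) [Field k] [CharP k 2] [IsAlgClosed k],
      (∀ m : ℕ, m < 3 → ∀ g : MvPowerSeries (Fin m) k,
        CobordantGame.IsSingular k g → CobordantGame.Won k m g) →
      (∀ (A₀ : MvPowerSeries (Fin 2) k), (2 : ℕ∞) < A₀.order →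
        ((∃ (r s : ℕ) (U : MvPowerSeries (Fin 2) k), MvPowerSeries.constantCoeff U ≠ 0 ∧ ¬ (2 ∣ r ∧ 2 ∣ s) ∧
            A₀ = MvPowerSeries.X (0 : Fin 2) ^ r * MvPowerSeries.X (1 : Fin 2) ^ s * U) ∨
          (∃ (i : Fin 2) (m : ℕ) (g : MvPowerSeries (Fin 2) k), 0 < m ∧ g.order = 1 ∧
            A₀ = MvPowerSeries.X i ^ (2 * m) * g)) →
        CobordantGame.Won k 3 (MvPowerSeries.X (Fin.last 2) ^ 2 +
          MvPowerSeries.rename (Fin.succAboveEmb (Fin.last 2)) A₀)) →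
      ∀ (A₀ : MvPowerSeries (Fin 2) k), (2 : ℕ∞) < A₀.order →
        CobordantGame.Won k 3 (MvPowerSeries.X (Fin.last 2) ^ 2 +
          MvPowerSeries.rename (Fin.succAboveEmb (Fin.last 2)) A₀) := by
  intro k _ _ _ hlow hterm A₀ hA₀
  obtain ⟨κ, hκ⟩ := hrank k
  exact insepWon_of_rank k (hlow 1 (by norm_num)) _ (fun B hB => hterm B hB.1 hB.2) κ hκ A₀ hA₀

end Summit.ResolutionOfSingularities.ResolutionOfSingularities.Theorems
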